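import Mathlib
import Summits.RiemannHypothesis.RiemannHypothesis.Theorems.WeilFormatCDeflatedFarCorrection
import HarnessLib

/-!
# Format C, design C∞: soundness of the deflated certificate with LIMIT data under a kernel envelope

Route context: Fourier–Galerkin / Schur-complement certificates of Weil positivity on a window ("format C";
cell memo `run/shared/lean/pub/rh-explicit/rh-explicit-weil-10/KERNEL-LEVER.md` §17–§18; supporting
stmt-RiemannHypothesis-0098; seat rh-explicit-weil-10).

This is the analytic entry point of a C∞ rung.  The abstract limit wrapper
(`sum_range_mul_mul_nonneg_of_certificate_deflated_limit`, p343540) left three `ε`–`P` approximation clauses to its user;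
here all three are DISCHARGED from hypotheses a door can supply:

* the KERNEL: symmetric `M : ℕ → ℕ → ℝ` with an envelope `|M(n,m)| ≤ C₀/|n − m|` (`n ≠ m`), `|M(n,n)| ≤ C₁ + C₂ log(1 + n)`
  (for Yoshida's sector kernels: `WeilFormatCKernelEnvelope`);
* the PROFILES: a table `V : ℕ → Fin r → ℝ` with `|V(n,j)| ≤ K/n³` for `n ≥ B` (window polynomials, `WeilFormatCWindowCoeffDecay`)
  and its LIMIT IMAGES `c∞(m,j) = lim_P Σ_{n∈[B,P)} M(n,m)V(n,j)` for every `m` (closed forms, `WeilFormatCDeflatedFarImages`);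
* the LIMIT ENTRIES: `G∞(j,j') = lim Σ_{n,m∈[B,P)} V(n,j)M(n,m)V(m,j')` (profile × profile band entries),
  `E∞(j,j') = lim Σ_{n∈[B,P)} V(n,j)V(n,j')` (Parseval), and the `d̂`-weighted entries `A∞`, `ρ∞`, `σ∞` of the correction
  (limits of `Σ_m V(m,j)V(m,j')/d̂_m`, `Σ_m V(m,j)M(i,m)/d̂_m`, `Σ_m V(m,j)c^P(m,j'')/d̂_m`);
* the DATA: a far diagonal `d̂ ≥ d₀ > 0` on `[B, ∞)` with its far inequality, a free map `Λ` with
  `Σ_j |Λ(x,β)_j| ≤ λ(Σ|x_i| + Σ|β_j|)`, a majorant `Uq` of the LIMIT coupling for every truncation `N`, and ONE kernel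
  inequality with margin `δ > 0` between the limit augmented Gram form, `Uq` and the limit correction.

Conclusion: `0 ≤ Σ_{n,m<N} y_n y_m M(n,m)` for every `N`, `y` — i.e. the sector kernel is a nonnegative form, the
hypothesis of `weilPositivityOn_of_sector_kernels_nonneg`.  The three clauses come from `exists_blockQuadForm_approx`
(p353207), `exists_coupling_approx` (`WeilFormatCDeflatedFarCoupling`) and `exists_correction_approx`
(`WeilFormatCDeflatedFarCorrection`).  Pure real analysis; standard axioms; nothing Weil-specific; no RH claim.
-/

-- `Summit.RiemannHypothesis.RiemannHypothesis.…` is the layout-mandated namespace (summit = problem name).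
set_option linter.dupNamespace false

namespace Summit.RiemannHypothesis.RiemannHypothesis.Theorems.WeilFormatC

open Finset Filter Topology

/-- **Soundness of the deflated format-C certificate with limit data, under a kernel envelope** (design C∞; see the
module docstring for the roles of the hypotheses).  The kernel inequality `hS` is stated for the LIMIT objects only:
`δ(Σx² + Σβ²) ≤ [Σ x x M + 2Σ x_iβ_j c∞(i,j) + Σ β β G∞] − Uq(x,β) + [2Σ_j Λ_j((β_j − Σ E∞β) + (Σ ρ∞x + Σ σ∞β)) − ΣΣ Λ_jΛ_{j'}A∞]`. -/
theorem sum_range_mul_mul_nonneg_of_certificate_cinf (M : ℕ → ℕ → ℝ) (hsymm : ∀ n m, M n m = M m n)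
    {B : ℕ} (hB : 1 ≤ B) {r : ℕ} (V : ℕ → Fin r → ℝ) (dhat : ℕ → ℝ)
    {d₀ C₀ C₁ C₂ K : ℝ} (hd₀ : 0 < d₀) (hC₀ : 0 ≤ C₀) (hC₁ : 0 ≤ C₁) (hC₂ : 0 ≤ C₂) (hK : 0 ≤ K)
    (hd : ∀ m, B ≤ m → d₀ ≤ dhat m)
    (hfar : ∀ (N : ℕ) (y : ℕ → ℝ),
      ∑ n ∈ Ico B N, dhat n * y n ^ 2 ≤ ∑ n ∈ Ico B N, ∑ m ∈ Ico B N, y n * M n m * y m)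
    (hoff : ∀ n m, n ≠ m → |M n m| ≤ C₀ / |(n : ℝ) - m|)
    (hdiag : ∀ n, |M n n| ≤ C₁ + C₂ * Real.log (1 + n))
    (hV : ∀ n j, B ≤ n → |V n j| ≤ K / (n : ℝ) ^ 3)
    -- limit images and limit entries
    (cinf : ℕ → Fin r → ℝ)
    (hc : ∀ m j, Tendsto (fun P ↦ ∑ n ∈ Ico B P, M n m * V n j) atTop (𝓝 (cinf m j)))
    (Ginf : Fin r → Fin r → ℝ)
    (hG : ∀ j j', Tendsto (fun P ↦ ∑ n ∈ Ico B P, ∑ m ∈ Ico B P, V n j * M n m * V m j') atTop (𝓝 (Ginf j j')))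
    (Einf Ainf σinf : Fin r → Fin r → ℝ) (ρinf : Fin r → Fin B → ℝ)
    (hE : ∀ j j', Tendsto (fun P ↦ ∑ n ∈ Ico B P, V n j * V n j') atTop (𝓝 (Einf j j')))
    (hA : ∀ j j', Tendsto (fun P ↦ ∑ m ∈ Ico B P, V m j * V m j' / dhat m) atTop (𝓝 (Ainf j j')))
    (hρ : ∀ (j : Fin r) (i : Fin B), Tendsto (fun P ↦ ∑ m ∈ Ico B P, V m j * M i m / dhat m) atTop (𝓝 (ρinf j i)))
    (hσ : ∀ j j'', Tendsto (fun P ↦ ∑ m ∈ Ico B P, V m j * (∑ n ∈ Ico B P, M n m * V n j'') / dhat m) atTop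
      (𝓝 (σinf j j'')))
    -- data
    (Λ : (Fin B → ℝ) → (Fin r → ℝ) → Fin r → ℝ) {lam : ℝ} (hlam : 0 ≤ lam)
    (hΛ : ∀ (x : Fin B → ℝ) (β : Fin r → ℝ), ∑ j, |Λ x β j| ≤ lam * (∑ i, |x i| + ∑ j, |β j|))
    (Uq : (Fin B → ℝ) → (Fin r → ℝ) → ℝ)
    (hUq : ∀ (N : ℕ) (x : Fin B → ℝ) (β : Fin r → ℝ),
      ∑ m ∈ Ico B N, (∑ i : Fin B, M i m * x i + ∑ j, cinf m j * β j) ^ 2 / dhat m ≤ Uq x β)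
    {δ : ℝ} (hδ : 0 < δ)
    (hS : ∀ (x : Fin B → ℝ) (β : Fin r → ℝ),
      δ * (∑ i, x i ^ 2 + ∑ j, β j ^ 2) ≤
        ((∑ i : Fin B, ∑ i' : Fin B, x i * x i' * M i i')
          + 2 * (∑ i : Fin B, ∑ j : Fin r, x i * β j * cinf i j)
          + (∑ j : Fin r, ∑ j' : Fin r, β j * β j' * Ginf j j'))
        - Uq x β
        + ((2 * ∑ j, Λ x β j * ((β j - ∑ j', Einf j j' * β j') + (∑ i, ρinf j i * x i + ∑ j'', σinf j j'' * β j'')))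
          - ∑ j, ∑ j', Λ x β j * Λ x β j' * Ainf j j'))
    (N : ℕ) (y : ℕ → ℝ) :
    0 ≤ ∑ n ∈ range N, ∑ m ∈ range N, y n * y m * M n m := by
  refine sum_range_mul_mul_nonneg_of_certificate_deflated_envelope M hsymm hB V dhat hd₀ hC₀ hC₁ hC₂ hK hd hfar
    hoff hdiag hV cinf (fun m j _ ↦ hc m j) Λ
    (fun x β ↦ (∑ i : Fin B, ∑ i' : Fin B, x i * x i' * M i i') + 2 * (∑ i : Fin B, ∑ j : Fin r, x i * β j * cinf i j)
      + (∑ j : Fin r, ∑ j' : Fin r, β j * β j' * Ginf j j'))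
    Uq
    (fun x β ↦ (2 * ∑ j, Λ x β j * ((β j - ∑ j', Einf j j' * β j') + (∑ i, ρinf j i * x i + ∑ j'', σinf j j'' * β j'')))
      - ∑ j, ∑ j', Λ x β j * Λ x β j' * Ainf j j')
    hδ (fun x β ↦ by linarith [hS x β]) hUq ?_ ?_ N y
  · -- the augmented Gram clause: entrywise limits
    intro ε hε
    have hA' : ∀ i i' : Fin B, Tendsto (fun _ : ℕ ↦ M i i') atTop (𝓝 (M i i')) := fun _ _ ↦ tendsto_const_nhds
    have hC' : ∀ (i : Fin B) (j : Fin r),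
        Tendsto (fun P ↦ ∑ m ∈ Ico B P, M i m * V m j) atTop (𝓝 (cinf i j)) := by
      intro i j
      refine (hc i j).congr fun P ↦ Finset.sum_congr rfl fun m _ ↦ ?_
      rw [hsymm]
    obtain ⟨P₀, hP₀⟩ := exists_blockQuadForm_approx (A := fun _ i i' ↦ M i i')
      (C := fun P i j ↦ ∑ m ∈ Ico B P, M i m * V m j)
      (G := fun P j j' ↦ ∑ n ∈ Ico B P, ∑ m ∈ Ico B P, V n j * M n m * V m j') hA' hC' hG hε
    exact ⟨P₀, fun P hP x β ↦ hP₀ P hP x β⟩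
  · -- the correction clause: entrywise limits
    intro ε hε
    exact exists_correction_approx M B V dhat hE hA hρ hσ Λ hlam hΛ hε

end Summit.RiemannHypothesis.RiemannHypothesis.Theorems.WeilFormatC
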